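import Summits.HodgeConjecture.HodgeConjecture.Theses.BoundaryReadout
import Literature.AlgebraicGeometry.HodgeTheory.GysinKernelSplitHolds
import Literature.AlgebraicGeometry.HodgeTheory.GlobalInvariantCyclesProofs
import Literature.AlgebraicGeometry.HodgeTheory.FibreRestrictionsLocallyConstantRank
import Literature.AlgebraicGeometry.HodgeTheory.HyperplaneSectionMonodromyTrivialisations
import Literature.AlgebraicGeometry.Motives.ComplexPointsEhresmann
import Literature.AlgebraicGeometry.Motives.AlgPointsProperMapProofs
import Literature.AlgebraicGeometry.Motives.VeryGeneralComplexPoint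
import Literature.AlgebraicGeometry.Motives.VarietiesProperProofs
import Literature.AlgebraicGeometry.Motives.VarietiesQuasiCompactProofs
import Literature.AlgebraicGeometry.Motives.VarietiesGeometricallyIntegralProofs
import Literature.NumberTheory.Transcendental.AnalytificationConnectedOpen
import Literature.NumberTheory.Transcendental.AnalytificationSecondCountableProofs
import HarnessLib

/-!
# Crux `BoundaryAbsoluteness` (stmt-HodgeConjecture-15913), line `typewise_readout` — STUB 5C
# `stub_vanishingPropagation`: vanishing of a global class propagates from a covered fibre to the
# fibres over the smooth locus

For `f : 𝒳 ⟶ C` surjective from a smooth projective variety onto a smooth projective curve, finitely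
many smooth projective pieces `g_i : Y_i ⟶ X_o` jointly covering the fibre over `o ∈ C(ℂ)`, an open
`W ⊆ C` over which `f` is smooth of one relative dimension `d`, and a class `x ∈ Hᵏ(𝒳(ℂ); ℂ)`
killed by every `(g_i ≫ ι_o)^*`: `x|_{X_t} = 0` for every `ℂ`-point `t` of `C` over `W`.

Proof (all inputs are tree theorems): (a) Hodge III 8.2.7
(`Deligne1974_ker_pullback_eq_ker_pullback_resolution_holds`): `x` dies on an open `V ⊇ X_o(ℂ)` of
`𝒳(ℂ)`; (b) the tube lemma for the proper `f(ℂ)` (`AlgPoints.exists_isOpen_preimage_map_subset`):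
`f(ℂ)⁻¹U₀ ⊆ V` for an open `U₀ ∋ o`, so `x|_{X_s} = 0` for `s ∈ U₀`; (c) Ehresmann over `W`
(`exists_trivialisation_of_smoothOfRelativeDimension_morphismRestrict`) and the small contractible
opens of the surface `C(ℂ)` make `f` cohomologically locally trivial over `U = {s | s.pt ∈ W}`
(`isHomotopicallyLocallyTrivialOn_of_trivialisations`), i.e. the restrictions `s ↦ x|_{X_s}` form a
flat section of `Rᵏ f_* ℂ|_U`; (d) `U` is connected (SGA1 XII 2.4,
`ComplexPoints.isConnected_setOf_pt_mem_inter_of_isIrreducible`) and dense (`dense_setOf_pt_not_mem`),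
so it meets `U₀`, and a flat section vanishing at one point of the connected `U` vanishes on `U`
(`mem_of_isPreconnected_of_isOpen` with `isOpen_setOf_map_fiberι_eq_zero/_ne_zero`).

## References

* [DeligneHodgeIII1974] P. Deligne, Théorie de Hodge III, Publ. Math. IHÉS 44 (1974), Prop. 8.2.7.
* [VoisinHodgeI2002] C. Voisin, Hodge Theory and Complex Algebraic Geometry I (2002), Thm. 9.3, §9.2.1.
* [VoisinHodgeII2003] C. Voisin, Hodge Theory and Complex Algebraic Geometry II (2003), §3.1.1.
* [SGA1] A. Grothendieck, M. Raynaud, SGA 1, Exp. XII Prop. 2.4, Prop. 3.2 (v).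
-/

-- `Summit.HodgeConjecture.HodgeConjecture.Theorems` is the mandated namespace (single-problem summit),
-- flagged by `linter.dupNamespace`; the lakefile turns the linter off tree-wide, restated here.
set_option linter.dupNamespace false

noncomputable section

open CategoryTheory AlgebraicGeometry
open _root_.Topology _root_.Filter
open Literature.AlgebraicGeometry.Motives Literature.AlgebraicGeometry.HodgeTheory
open Literature.AlgebraicTopology.SingularHomology

namespace Summit.HodgeConjecture.HodgeConjecture.Theorems

namespace BoundaryAbsolutenessVanishingPropagation

variable {N : ℕ} {𝒳 C : SchemeOver ℂ} (f : 𝒳 ⟶ C)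

/-- A `ℂ`-morphism from a smooth projective variety to a smooth projective curve is proper
(`𝒳 → Spec ℂ` proper, `C → Spec ℂ` separated; Hartshorne II Cor. 4.8 (e)). [folklore] -/
theorem isProper_left (h𝒳 : IsSmoothProjective N 𝒳) (hC : IsSmoothProjective 1 C) : IsProper f.left := by
  haveI : IsProper C.hom := IsSmoothProjective.isProper_holds hC
  haveI : IsProper (f.left ≫ C.hom) := by
    rw [Over.w f]
    exact IsSmoothProjective.isProper_holds h𝒳
  exact IsProper.of_comp f.left C.hom

/-- **Local vanishing near the covered fibre** (Hodge III 8.2.7 + the tube lemma): if finitely many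
smooth projective pieces `g_i : Y_i ⟶ X_o` jointly cover the fibre of `f` over `o` and a class
`x ∈ Hᵏ(𝒳(ℂ); ℂ)` is killed by every `(g_i ≫ ι_o)^*`, then `x|_{X_s} = 0` for all `s` in an open
neighbourhood `U₀` of `o` in `C(ℂ)`. [cite: DeligneHodgeIII1974, Prop. 8.2.7]
[cite: SGA1, Exp. XII Prop. 3.2 (v)] -/
theorem exists_isOpen_forall_map_fiberι_eq_zero (o : AlgPoints C ℂ) (h𝒳 : IsSmoothProjective N 𝒳)
    (hC : IsSmoothProjective 1 C) {ι : Type} [Finite ι] {m : ι → ℕ} {Y : ι → SchemeOver ℂ}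
    (g : ∀ i, Y i ⟶ fiberOver f o) (hY : ∀ i, IsSmoothProjective (m i) (Y i))
    (hcov : ∀ x : ↥(fiberOver f o).left, ∃ (i : ι) (y : ↥(Y i).left), (g i).left.base y = x)
    (k : ℕ) (x : complexBetti 𝒳 k) (hx : ∀ i, complexBetti.map (g i ≫ fiberι f o) k x = 0) :
    ∃ U₀ : Set (AlgPoints C ℂ), IsOpen U₀ ∧ o ∈ U₀ ∧
      ∀ s ∈ U₀, complexBetti.map (fiberι f s) k x = 0 := by
  haveI : IsProper f.left := isProper_left f h𝒳 hC
  -- (a) Hodge III 8.2.7: `x` dies on an open `V ⊇ X_o(ℂ)`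
  obtain ⟨V, hVo, hZV, hxV⟩ :=
    Deligne1974_ker_pullback_eq_ker_pullback_resolution_holds h𝒳 hY (fun i => g i ≫ fiberι f o) k x hx
  -- the complex points over `o` lie in `V`
  have hfib : (AlgPoints.map f) ⁻¹' {o} ⊆ V := by
    intro P hP
    have hP' : P ∈ Set.range (AlgPoints.map (fiberι f o) : AlgPoints (fiberOver f o) ℂ → _) := by
      rw [AlgPoints.range_map_fiberι]; exact hP
    obtain ⟨Q, rfl⟩ := hP'
    obtain ⟨i, y, hy⟩ := hcov Q.pt
    refine hZV ?_
    simp only [Set.mem_setOf_eq, Set.mem_iUnion, Set.mem_range]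
    refine ⟨i, y, ?_⟩
    rw [AlgPoints.pt_map, ← hy, Over.comp_left, Scheme.Hom.comp_base, TopCat.comp_app]
  -- (b) tube lemma: a whole tube `f(ℂ)⁻¹ U₀` lies in `V`
  obtain ⟨U₀, hU₀o, hoU₀, hU₀V⟩ := AlgPoints.exists_isOpen_preimage_map_subset f o hVo hfib
  refine ⟨U₀, hU₀o, hoU₀, fun s hs => ?_⟩
  -- `x|_{X_s}` factors through `x|_V = 0`
  have htube : tubeOver f U₀ ⊆ V := hU₀V
  have hfac : complexBetti.map (fiberι f s) k x =
      fiberRestrict f hs k (singularCohomology.map ℂ ℂ (subsetInclusion htube) k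
        (singularCohomology.map ℂ ℂ (subsetIncl V) k x)) := by
    rw [← fiberRestrict_restrictTube_apply f hs k x, restrictTube]
    congr 1
    rw [← ModuleCat.comp_apply, ← singularCohomology.map_comp]
    rfl
  rw [hfac, hxV, map_zero, map_zero]

/-- **`Rᵏ f_* ℂ` is a local system over the complex points of an open of the base where `f` is
smooth of one relative dimension**: `f` is cohomologically locally trivial (by restriction) over
`{s ∈ C(ℂ) | s.pt ∈ W}` — Ehresmann over `W`
(`exists_trivialisation_of_smoothOfRelativeDimension_morphismRestrict`) and the small contractible
opens of the topological surface `C(ℂ)` (`isHomotopicallyLocallyTrivialOn_of_trivialisations`;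
Voisin I §9.2.1). [cite: VoisinHodgeI2002, §9.2.1 (with Thm. 9.3)] -/
theorem isCohomologicallyLocallyTrivialOn_setOf_pt_mem (h𝒳 : IsSmoothProjective N 𝒳)
    (hC : IsSmoothProjective 1 C) (W : C.left.Opens) (d : ℕ)
    (hW : SmoothOfRelativeDimension d (f.left ∣_ W)) :
    IsCohomologicallyLocallyTrivialOn f {s : ComplexPoints C | s.pt ∈ W} := by
  haveI : IsProper f.left := isProper_left f h𝒳 hC
  haveI : IsProper 𝒳.hom := IsSmoothProjective.isProper_holds h𝒳
  haveI : IsProper C.hom := IsSmoothProjective.isProper_holds hC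
  haveI : IsSeparated 𝒳.hom := inferInstance
  haveI : IsSeparated C.hom := inferInstance
  haveI : SmoothOfRelativeDimension 1 C.hom := hC.smoothOfRelativeDimension
  haveI : Smooth C.hom := SmoothOfRelativeDimension.smooth 1 _
  haveI : LocallyOfFiniteType C.hom := inferInstance
  haveI : LocallyOfFiniteType 𝒳.hom := inferInstance
  haveI : CompactSpace 𝒳.left := IsSmoothProjective.compactSpace_holds h𝒳
  haveI : CompactSpace C.left := IsSmoothProjective.compactSpace_holds hC
  haveI : SecondCountableTopology (ComplexPoints 𝒳) :=
    ComplexPoints.secondCountableTopology_of_compactSpace_holds 𝒳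
  haveI : SecondCountableTopology (ComplexPoints C) :=
    ComplexPoints.secondCountableTopology_of_compactSpace_holds C
  haveI := hW
  letI := ComplexPoints.chartedSpace C 1
  exact (isHomotopicallyLocallyTrivialOn_of_trivialisations f
    (fun t _ W' hW' ↦ exists_isOpen_contractibleSpace_of_chartedSpace (d := 2 * 1) t W' hW')
    (fun t ht ↦ exists_trivialisation_of_smoothOfRelativeDimension_morphismRestrict f W d 1 t ht)).isCohomologicallyLocallyTrivialOn

/-- **The complex points over a non-empty open of a smooth projective curve form a connected set**
(SGA1 XII Prop. 2.4: an open part of an irreducible variety is connected in the complex topology).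
[cite: SGA1, Exp. XII Prop. 2.4] -/
theorem isPreconnected_setOf_pt_mem (hC : IsSmoothProjective 1 C) (W : C.left.Opens)
    (hW : (W : Set C.left).Nonempty) : IsPreconnected {s : ComplexPoints C | s.pt ∈ W} := by
  haveI : SmoothOfRelativeDimension 1 C.hom := hC.smoothOfRelativeDimension
  haveI : Smooth C.hom := SmoothOfRelativeDimension.smooth 1 _
  haveI : LocallyOfFiniteType C.hom := inferInstance
  haveI : IsIntegral C.left := IsSmoothProjective.isIntegral_holds hC
  have h := ComplexPoints.isConnected_setOf_pt_mem_inter_of_isIrreducible C isClosed_univ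
    (IrreducibleSpace.isIrreducible_univ _) W (by simpa only [Set.univ_inter] using hW)
  simpa only [Set.mem_univ, true_and, SetLike.mem_coe] using h.isPreconnected

/-- **The complex points over a non-empty open of a smooth projective curve are dense in `C(ℂ)`**
(Zariski-dense opens have dense complex points; Serre, GAGA Prop. 5). [cite: SerreGAGA1956, §2 n°7 Prop. 5] -/
theorem dense_setOf_pt_mem (hC : IsSmoothProjective 1 C) (W : C.left.Opens)
    (hW : (W : Set C.left).Nonempty) : Dense {s : ComplexPoints C | s.pt ∈ W} := by
  haveI : SmoothOfRelativeDimension 1 C.hom := hC.smoothOfRelativeDimension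
  haveI : Smooth C.hom := SmoothOfRelativeDimension.smooth 1 _
  haveI : LocallyOfFiniteType C.hom := inferInstance
  haveI : IsIntegral C.left := IsSmoothProjective.isIntegral_holds hC
  have hcl : IsClosed ((W : Set C.left)ᶜ) := W.isOpen.isClosed_compl
  have hne : ((W : Set C.left)ᶜ) ≠ Set.univ := by
    intro h
    obtain ⟨w, hw⟩ := hW
    have : w ∈ ((W : Set C.left)ᶜ) := by rw [h]; exact Set.mem_univ w
    exact this hw
  have hd := ComplexPoints.dense_setOf_pt_not_mem (X := C) hcl hne
  simpa only [Set.mem_compl_iff, not_not, SetLike.mem_coe] using hd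

end BoundaryAbsolutenessVanishingPropagation

open BoundaryAbsolutenessVanishingPropagation in
/-- **STUB 5C of the line `typewise_readout` (registered on stmt-HodgeConjecture-15913) — vanishing
propagation.** For `f : 𝒳 ⟶ C` surjective from a smooth projective variety onto a smooth projective
curve, smooth projective pieces `g_i : Y_i ⟶ X_o` jointly covering the fibre over `o`, an open
`W ⊆ C` over which `f` is smooth of relative dimension `d`, and a class `x ∈ Hᵏ(𝒳(ℂ); ℂ)` with
`(g_i ≫ ι_o)^* x = 0` for all `i`: `ι_t^* x = 0` for every `ℂ`-point `t` of `C` over `W`. Hodge III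
8.2.7 + tube lemma give vanishing near `o`; Ehresmann over `W` makes the restrictions a flat section of
`Rᵏ f_* ℂ` over the connected dense `{s | s.pt ∈ W}`, which meets the neighbourhood of `o`; a flat
section vanishing at one point of a connected locus vanishes identically.
[cite: DeligneHodgeIII1974, Prop. 8.2.7] [cite: VoisinHodgeI2002, §9.2.1 and Thm. 9.3]
[cite: VoisinHodgeII2003, §3.1.1] -/
theorem stub_vanishingPropagation :
    ∀ ⦃N : ℕ⦄ ⦃𝒳 C : SchemeOver ℂ⦄ (f : 𝒳 ⟶ C) (o : AlgPoints C ℂ),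
      IsSmoothProjective N 𝒳 → IsSmoothProjective 1 C → Function.Surjective f.left.base →
      ∀ ⦃ι : Type⦄ [Finite ι] ⦃m : ι → ℕ⦄ ⦃Y : ι → SchemeOver ℂ⦄ (g : ∀ i, Y i ⟶ fiberOver f o),
        (∀ i, IsSmoothProjective (m i) (Y i)) →
        (∀ x : ↥(fiberOver f o).left, ∃ (i : ι) (y : ↥(Y i).left), (g i).left.base y = x) →
        ∀ (W : C.left.Opens) (d : ℕ), SmoothOfRelativeDimension d (f.left ∣_ W) →
        ∀ (k : ℕ) (x : complexBetti 𝒳 k),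
          (∀ i, complexBetti.map (g i ≫ fiberι f o) k x = 0) →
          ∀ (t : AlgPoints C ℂ), t.pt ∈ W → complexBetti.map (fiberι f t) k x = 0 := by
  intro N 𝒳 C f o h𝒳 hC _hf ι _ m Y g hY hcov W d hW k x hx t ht
  -- (a)+(b): vanishing on the fibres over an open neighbourhood `U₀` of `o`
  obtain ⟨U₀, hU₀o, hoU₀, hvan⟩ := exists_isOpen_forall_map_fiberι_eq_zero f o h𝒳 hC g hY hcov k x hx
  -- (c): the local system over `U = {s | s.pt ∈ W}`
  set U : Set (ComplexPoints C) := {s | s.pt ∈ W} with hUdef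
  have hlt : IsCohomologicallyLocallyTrivialOn f U :=
    isCohomologicallyLocallyTrivialOn_setOf_pt_mem f h𝒳 hC W d hW
  have hWne : (W : Set C.left).Nonempty := ⟨t.pt, ht⟩
  have hUc : IsPreconnected U := isPreconnected_setOf_pt_mem hC W hWne
  -- (d): `U` is dense, so it meets `U₀` in some `s₀`, where `x|_{X_{s₀}} = 0`
  obtain ⟨s₀, hs₀U₀, hs₀U⟩ : (U₀ ∩ U).Nonempty :=
    (dense_setOf_pt_mem hC W hWne).inter_open_nonempty U₀ hU₀o ⟨o, hoU₀⟩
  have h₀ : complexBetti.map (fiberι f s₀) k x = 0 := hvan s₀ hs₀U₀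
  -- a flat section vanishing at `s₀ ∈ U` vanishes at `t ∈ U`
  by_contra hne
  exact map_fiberι_ne_zero_of_isPreconnected hlt hUc x ht hs₀U hne h₀

end Summit.HodgeConjecture.HodgeConjecture.Theorems

end
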